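import Mathlib.RingTheory.AdjoinRoot
import Mathlib.RingTheory.RootsOfUnity.PrimitiveRoots
import Mathlib.NumberTheory.NumberField.Basic
import Mathlib.Algebra.CharP.Defs
import Literature.AlgebraicGeometry.Motives.GoodReduction
import Literature.AlgebraicGeometry.Motives.ZetaFunction
import HarnessLib

/-!
# μ-ordinary potentially good reduction of Picard curves at `3`

A *Picard curve* over a field `K` of characteristic `≠ 3` is the smooth projective curve `C_f`
with affine equation `y³ = f(x)`, `f ∈ K[x]` a separable quartic; it has genus `3`, an
automorphism `σ : y ↦ ω y` of order `3` with quotient `ℙ¹`, and its Jacobian has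
`ℤ[ω]`-multiplication of signature `(2, 1)`. This file formalises the notion requested by route
`PicardMuOrdinary` of the Langlands summit (definition request D1):

* `HasMuOrdinaryReductionAtThree f` (`f : ℤ[X]`): the Picard curve `y³ = f(x)` has
  *potentially good* reduction at `3` — over some finite extension `M ∋ ω` and a place `w ∣ 3`
  of `M` it has a smooth proper model over the local ring `𝓞_{M,w}` (Bouw–Koutsianas–Sijsling–
  Wewers, Def. 29) — whose special fibre has `3`-rank `2` **and** such that the Frobenius of the
  residue field `k(w)` acting on the rank-`2` unit-root (étale) part of `J[3^∞]` of the special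
  fibre has two *distinct* eigenvalues ("`λ`-distinguished").

Background (why "`3`-rank `2`" is the *μ-ordinary* case). If a Picard curve over a `3`-adic field
has good reduction, the proof of [BouwEtAl2020, Prop. 30] shows that the (geometric) special
fibre, with the reduction of `σ`, is an Artin–Schreier cover of `ℙ¹` of degree `3` with either ONE
branch point — then it is `y³ - y = x⁴` — or TWO branch points — then it is
`x y³ - x y = g(x)` with `deg g = 3`. By the Deuring–Šafarevič formula the `3`-rank of
`y³ - y = h(x)` with `r` branch points is `2 (r - 1)`, i.e. `0` in the first case and `2` in the
second; `3`-rank `3` (ordinary) never occurs. Indeed, since `λ = 1 - ω` is ramified,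
`ℚ₃(ω) ⊗ W(k)[1/3]` is a field, every slope of an abelian threefold with `ℤ[ω]`-multiplication in
characteristic `3` has even multiplicity, and the only possible Newton polygons are
`(0, 0, ½, ½, 1, 1)` — `3`-rank `2`, the lowest = generic one, "μ-ordinary" — and the
supersingular one — `3`-rank `0`. The five possible stable reduction types of
a Picard curve at `p = 3` are classified in [BornerBouwWewers2017, §3.1] (case (a) = potentially
good reduction); [BouwEtAl2020, Rem. 72] records `f₃ ≥ 6` for the conductor exponent in that case.
Hence, *given* potentially good reduction, "special fibre of two-branch-point type" and
"`3`-rank `2`" are equivalent, and the definition below is phrased through the `3`-rank, as the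
request allows.

## Main definitions

* `FrobeniusEigenvalues q N F`: for a point-count function `N : ℕ → ℕ` (think
  `N m = #X(𝔽_{q^m})` for a smooth projective geometrically connected curve `X / 𝔽_q`) and a
  number field `F`, a presentation `N m = q^m + 1 - ∑ᵢ αᵢ^m` (`m ≥ 1`) by a multiset `α` of
  non-zero algebraic integers of `F` — the Frobenius eigenvalues on `H¹`, i.e. the reciprocal
  roots of the `L`-polynomial (Weil). `E.unitRoots 𝔓` are the `αᵢ` prime to a prime `𝔓` of `F`.
* `HasSimpleUnitRoots p q N r`: there are exactly `r` unit-root eigenvalues at (a prime above) `p`,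
  counted with multiplicity, and they are pairwise distinct. For the point counts of a curve over
  `𝔽_q`, `q = pᵃ`, "`r` unit roots" says that the `p`-rank of its Jacobian is `r` (the `p`-rank is
  the number of Frobenius eigenvalues that are `p`-adic units = the multiplicity of the slope `0`;
  Manin 1961, Katz 1979; `p`-rank as in [LiOort1998, Introduction]) and "pairwise distinct" says
  that Frobenius acts on `T_p J^{ét} ⊗ ℚ_p` (whose characteristic polynomial is
  `∏_{unit αᵢ} (T - αᵢ)`) with `r` distinct eigenvalues. `SchemeOver.HasSimpleUnitRoots X r`
  specialises to `N = pointCount X` (file `ZetaFunction`), `q = #k`, `p = char k`.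
* `picardAffineRing f M = M[x][y]/(y³ - f(x))`, `picardAffineCurve f M = Spec` of it over `M`, and
  `IsPicardCurve f C`: `C` is a smooth proper integral `M`-curve containing the affine Picard
  curve as an open `M`-subscheme — i.e. `C` is *the* smooth projective model of `y³ = f(x)` over
  `M` (a regular proper integral curve over a field is determined by any dense open subscheme:
  uniqueness of the regular projective model of a function field, Liu 2002, §7.3; Hartshorne I.6).
* `MuOrdinaryModelAtThree f M`: the witness structure over a number field `M` (`ω ∈ M`, a place
  `w ∣ 3`, the Picard curve `C / M`, a smooth proper `IntegralModel` over
  `𝓞_{M,w} = valuationSubringAtPrime M w` — the vocabulary of file `GoodReduction` — and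
  `HasSimpleUnitRoots` of the special fibre with `r = 2`), and
  `HasMuOrdinaryReductionAtThree f := ∃ M, Nonempty (MuOrdinaryModelAtThree f M)` (the pattern of
  `HasPotentialGoodReductionAt`).

## Design notes

* **Global instead of local fields.** The request speaks of a finite extension `M / ℚ₃(ω)`; we
  quantify over number fields `M ∋ ω` with a place `w ∣ 3` and use the (non-complete) local ring
  `𝓞_{M,w}`, exactly as `HasGoodReductionAt` / `HasPotentialGoodReductionAt` in `GoodReduction`.
  The two formulations are equivalent: a model over `𝓞_{M,w}` completes to one over `𝓞_{M_w}`
  with the same special fibre; conversely a finite `M' / ℚ₃(ω)` is the completion of a number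
  field `M ∋ ω` (Krasner), and a smooth proper model over the completion descends to `𝓞_{M,w}`
  because the minimal regular model exists over this excellent discrete valuation ring and its
  formation commutes with completion (Liu 2002, Ch. 9.3 and Ch. 10.1; [BLRNeronModels1990]).
* **No `Proj`.** Mathlib has `Proj` but no convenient graded quotient; the Picard curve is pinned
  down by `IsPicardCurve` (smooth + proper + integral + an open immersion of the explicit affine
  curve), which determines it up to unique `M`-isomorphism. For `f` not a separable quartic the
  predicate may simply be unsatisfiable (e.g. `f = 0`: the affine curve is not reduced).
* **`3`-rank and eigenvalues through point counts.** Mathlib has no Jacobians, `p`-divisible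
  groups or Dieudonné modules; but the `3`-rank and the Frobenius eigenvalues on the étale part
  of `J[3^∞]` of a smooth proper curve over a finite field are determined by its zeta function,
  hence by `pointCount` (file `ZetaFunction`): see `HasSimpleUnitRoots`. The data
  `(F, 𝔓, α)` in `FrobeniusEigenvalues` / `HasSimpleUnitRoots` are quantified existentially; the
  multiset `α` is unique (power sums determine a multiset of non-zero elements in characteristic
  `0`) and the number and the distinctness of the unit roots do not depend on `(F, 𝔓)` (the roots
  of the `L`-polynomial form a Galois-stable multiset and `Gal` permutes the primes above `p`
  transitively), so `∃` and `∀` readings agree.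
* **"`λ`-distinguished" is a characteristic-`0` condition.** Over `M ∋ ω` the reduction of `σ`
  makes `T₃ J[3^∞]^{ét} ≅ ℤ₃²` a torsion-free, hence free rank-one, `ℤ₃[ω]`-module on which
  `Frob_{k(w)}` acts `ℤ₃[ω]`-linearly, i.e. by a unit `u ∈ ℤ₃[ω]ˣ`; its two eigenvalues are `u`
  and its conjugate `ū`, which always agree modulo `λ`. So "two distinct eigenvalues" can only
  mean `u ≠ ū` in characteristic `0` (equivalently `u ∉ ℤ₃`), and this is what `Nodup` of the
  unit roots expresses.
* **Dependence on `M`.** Enlarging `M` keeps good reduction and the `3`-rank but replaces the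
  residue field `𝔽_q` by `𝔽_{q^d}` and `(u, ū)` by `(u^d, ū^d)`; incomparable fields `M` may give
  twisted `𝔽_q`-forms of the same geometric special fibre. The informal notion ("over the finite
  extension where good reduction is attained") does not fix `M`; we take the existential reading:
  *some* `M ∋ ω` with good reduction at *some* `w ∣ 3` has distinct unit-root eigenvalues.
* What is NOT here: no construction of `C_f` or of any model, no semistable-reduction algorithm,
  no claim that a given `f` satisfies the predicate, no Jacobians; the two-branch-point equation
  of the special fibre is a documented consequence ([BouwEtAl2020, Prop. 30]), not a field.

## References

* [BouwEtAl2020] I. Bouw, A. Koutsianas, J. Sijsling, S. Wewers, *Conductor and discriminant of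
  Picard curves*, J. LMS 102 (2020), Def. 29, Prop. 30, Rem. 72 (arXiv:1902.09624 numbering).
* [BornerBouwWewers2017] M. Börner, I. Bouw, S. Wewers, *Picard curves with small conductor*,
  §3.1 (stable reduction at `p = 3`, cases (a)–(e)).
* [LiOort1998] K.-Z. Li, F. Oort, *Moduli of supersingular abelian varieties*, LNM 1680,
  Introduction (`p`-rank, Newton polygons).
* [Weil1949] A. Weil, *Numbers of solutions of equations in finite fields* (eigenvalue form of
  the zeta function of a curve); Yu. Manin, *The Hasse–Witt matrix of an algebraic curve* (1961);
  N. Katz, *Slope filtration of F-crystals* (1979) (`p`-rank = number of unit-root eigenvalues).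
* [Liu2002] Q. Liu, *Algebraic geometry and arithmetic curves*, §7.3, Ch. 9.3, Ch. 10.1;
  [BLRNeronModels1990] (models, minimal regular models, completion).
-/

open CategoryTheory AlgebraicGeometry IsDedekindDomain Polynomial
open scoped NumberField

noncomputable section

namespace Literature.AlgebraicGeometry.Motives

/-! ### Frobenius eigenvalues, unit roots and the `p`-rank, read off from point counts -/

/-- **Frobenius eigenvalues of a point-count function.** For `N : ℕ → ℕ` (the point counts
`N m = #X(𝔽_{q^m})` of a smooth projective geometrically connected curve `X / 𝔽_q`) and a number
field `F`, a presentation `N m + ∑ᵢ αᵢ^m = q^m + 1` for all `m ≥ 1` by a multiset `α` of NON-ZERO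
algebraic integers of `F`: the eigenvalues of Frobenius on `H¹`, i.e. the reciprocal roots of the
numerator `L(T) = ∏ᵢ (1 - αᵢ T)` of the zeta function (Weil 1949; Serre, *Zeta and L functions*,
§1; for a curve of genus `g` there are `2g` of them, of absolute value `√q`). Normalising `0 ∉ α`
makes `α` unique: in characteristic `0` a finite multiset of non-zero elements is determined by
its power sums `∑ᵢ αᵢ^m`, `m ≥ 1`. The structure only records the identities; it does not assert
that `N` comes from a curve. [folklore] -/
structure FrobeniusEigenvalues (q : ℕ) (N : ℕ → ℕ) (F : Type*) [Field F] [NumberField F] where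
  /-- The Frobenius eigenvalues (reciprocal roots of the `L`-polynomial), as algebraic integers
  of the number field `F`, with multiplicity. -/
  α : Multiset (𝓞 F)
  /-- Normalisation: no eigenvalue is zero (so that `α` is determined by `N`). -/
  zero_not_mem : (0 : 𝓞 F) ∉ α
  /-- The point-count identities `N m + ∑ᵢ αᵢ^m = q^m + 1` for all `m ≥ 1`. -/
  count_eq : ∀ m : ℕ, 0 < m → (N m : 𝓞 F) + (α.map (· ^ m)).sum = (q : 𝓞 F) ^ m + 1

namespace FrobeniusEigenvalues

variable {q : ℕ} {N : ℕ → ℕ} {F : Type*} [Field F] [NumberField F]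
  (E : FrobeniusEigenvalues q N F)

/-- The **unit-root eigenvalues** at a prime `𝔓` of `F`: the sub-multiset of the Frobenius
eigenvalues `αᵢ` that are units at `𝔓` (`αᵢ ∉ 𝔓`). When `𝔓 ∣ p = char 𝔽_q` these are the
eigenvalues of `p`-adic valuation `0` — the slope-`0` part of the Newton polygon — and their number
is the `p`-rank of the Jacobian (Manin 1961; Katz 1979; `p`-rank as in Li–Oort, Introduction).
[folklore] -/
def unitRoots (𝔓 : HeightOneSpectrum (𝓞 F)) : Multiset (𝓞 F) :=
  open scoped Classical in E.α.filter (· ∉ 𝔓.asIdeal)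

/-- The unit roots form a sub-multiset of all Frobenius eigenvalues. [folklore] -/
theorem unitRoots_le (𝔓 : HeightOneSpectrum (𝓞 F)) : E.unitRoots 𝔓 ≤ E.α := by
  classical
  unfold unitRoots
  convert Multiset.filter_le (fun a => a ∉ 𝔓.asIdeal) E.α

/-- Membership in the unit roots: an eigenvalue not lying in `𝔓`. [folklore] -/
theorem mem_unitRoots {𝔓 : HeightOneSpectrum (𝓞 F)} {a : 𝓞 F} :
    a ∈ E.unitRoots 𝔓 ↔ a ∈ E.α ∧ a ∉ 𝔓.asIdeal := by
  classical
  unfold unitRoots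
  convert Multiset.mem_filter (p := fun a => a ∉ 𝔓.asIdeal) (a := a) (s := E.α)

/-- The number of unit roots (the `p`-rank) is at most the number of all eigenvalues (`2g`):
`0 ≤ p-rank ≤ 2g` in this crude form (the sharp bound `≤ g` needs the functional equation).
[folklore] -/
theorem card_unitRoots_le (𝔓 : HeightOneSpectrum (𝓞 F)) :
    Multiset.card (E.unitRoots 𝔓) ≤ Multiset.card E.α :=
  Multiset.card_le_card (E.unitRoots_le 𝔓)

end FrobeniusEigenvalues

/-- **`r` simple unit roots.** For a prime number `p`, a prime power `q = pᵃ` and a point-count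
function `N` (of a smooth projective geometrically connected curve `X / 𝔽_q`): the Frobenius
eigenvalues of `N` exist as algebraic integers and, at a prime `𝔓 ∣ p` of the field containing
them, exactly `r` of them (counted with multiplicity) are `𝔓`-units, and these `r` are pairwise
distinct. Dictionary: "`r` unit roots" ⟺ the `p`-rank of `Jac X` is `r`
(`#Jac X[p](k̄) = p^r`; the `p`-rank equals the number of unit-root Frobenius eigenvalues, Manin
1961, Katz 1979); "pairwise distinct" ⟺ the `q`-Frobenius acting on the `p`-adic Tate module of
the étale part `Jac X[p^∞]^{ét}` (rank `r`, characteristic polynomial `∏_{unit αᵢ} (T - αᵢ)`) has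
`r` distinct eigenvalues. The data `(F, 𝔓, α)` are quantified existentially; `α` is unique and the
two conditions do not depend on the choice of `(F, 𝔓)` (Galois permutes the primes above `p`
transitively and preserves the multiset of roots of `L(T) ∈ ℤ[T]`). [folklore] -/
def HasSimpleUnitRoots (p q : ℕ) (N : ℕ → ℕ) (r : ℕ) : Prop :=
  ∃ (F : Type) (_ : Field F) (_ : NumberField F) (E : FrobeniusEigenvalues q N F)
    (𝔓 : HeightOneSpectrum (𝓞 F)),
    (p : 𝓞 F) ∈ 𝔓.asIdeal ∧ Multiset.card (E.unitRoots 𝔓) = r ∧ (E.unitRoots 𝔓).Nodup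

section FiniteField

variable {k : Type} [Field k] [Finite k]

/-- **`r` simple unit roots for a scheme over a finite field** `k = 𝔽_q` (intended: a smooth
proper geometrically connected curve): `HasSimpleUnitRoots` for `p = char k`, `q = #k` and the
point counts `N m = pointCount X m = #X(𝔽_{q^m})` of file `ZetaFunction`. For such a curve this
says: the `p`-rank of `Jac X` is `r` and Frobenius has `r` distinct eigenvalues on the unit-root
(étale) part of `Jac X[p^∞]`. Declared on the `SchemeOver` abbreviation for dot notation.
[folklore] -/
def SchemeOver.HasSimpleUnitRoots (X : SchemeOver k) (r : ℕ) : Prop :=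
  Motives.HasSimpleUnitRoots (ringChar k) (Nat.card k) (pointCount X) r

end FiniteField

/-! ### Picard curves -/

section Picard

variable (f : ℤ[X]) (M : Type) [Field M]

/-- The affine coordinate ring `M[x][y] / (y³ - f(x))` of the Picard curve `y³ = f(x)` over a field
`M` (`f ∈ ℤ[x]` mapped to `M[x]`), as Mathlib's `AdjoinRoot` of `Y³ - C f ∈ M[x][Y]`; an
`M`-algebra.
Picard curves `y³ = f(x)`, `f` a separable quartic: [BouwEtAl2020, §1, Def. 1 and Lemma 3].
[cite: BouwEtAl2020, §1, Def. 1 and Lemma 3 (arXiv:1902.09624 numbering)] -/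
abbrev picardAffineRing : Type :=
  AdjoinRoot (X ^ 3 - C (f.map (Int.castRingHom M)) : M[X][X])

/-- The defining relation `y³ = f(x)` holds in `picardAffineRing f M` (`y = AdjoinRoot.root`,
`f(x) =` the image of `f ∈ M[x]`). [folklore] -/
theorem picardAffineRing_root_pow_three :
    AdjoinRoot.root (X ^ 3 - C (f.map (Int.castRingHom M)) : M[X][X]) ^ 3 =
      AdjoinRoot.of (X ^ 3 - C (f.map (Int.castRingHom M)) : M[X][X])
        (f.map (Int.castRingHom M)) := by
  have h := AdjoinRoot.eval₂_root (X ^ 3 - C (f.map (Int.castRingHom M)) : M[X][X])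
  rw [eval₂_sub, eval₂_pow, eval₂_X, eval₂_C] at h
  exact sub_eq_zero.mp h

/-- The affine Picard curve `U_f = Spec (M[x][y] / (y³ - f(x)))` as an `M`-scheme
(`specOver`, file `Varieties`). For `f` a separable quartic and `char M ≠ 3` it is a smooth affine
curve whose smooth compactification is the Picard curve, with ONE point at infinity.
[cite: BouwEtAl2020, §1, Def. 1 and Lemma 3 (arXiv:1902.09624 numbering)] -/
def picardAffineCurve : SchemeOver M :=
  specOver M (picardAffineRing f M)

variable {M}

/-- **`C` is the Picard curve `y³ = f(x)` over `M`**: `C → Spec M` is smooth of relative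
dimension `1` and proper, `C` is integral, and the affine Picard curve
`Spec (M[x][y] / (y³ - f(x)))` admits an open immersion into `C` over `M`. Since a non-empty open
subscheme of an integral scheme is dense and a regular proper integral curve over a field is
determined up to unique isomorphism by a dense open subscheme (uniqueness of the regular
projective model of a function field: Liu 2002, §7.3; Hartshorne I.6), such a `C` is exactly the
smooth projective model of `y³ = f(x)` — for a separable quartic `f`, the smooth plane quartic
`y³ z = F(x, z)` of genus `3` [BouwEtAl2020, §1]. No `C` exists unless the affine curve is itself
smooth (e.g. none for `f = 0`).
[cite: BouwEtAl2020, §1, Def. 1 and Lemma 3 (arXiv:1902.09624 numbering)] -/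
structure IsPicardCurve (C : SchemeOver M) : Prop where
  /-- `C → Spec M` is smooth of relative dimension `1`. -/
  smooth : SmoothOfRelativeDimension 1 C.hom
  /-- `C → Spec M` is proper. -/
  isProper : IsProper C.hom
  /-- `C` is an integral scheme. -/
  isIntegral : IsIntegral C.left
  /-- The affine Picard curve is an open `M`-subscheme of `C`. -/
  exists_isOpenImmersion : ∃ ι : picardAffineCurve f M ⟶ C, IsOpenImmersion ι.left

end Picard

/-! ### μ-ordinary potentially good reduction at `3` -/

section MuOrdinary

open IsDedekindDomain.HeightOneSpectrum

/-- **Witness for μ-ordinary (`3`-rank `2`, `λ`-distinguished) potentially good reduction at `3`**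
of the Picard curve `y³ = f(x)`, over a number field `M`: `M` contains a primitive cube root of
unity (so `M_w ⊇ ℚ₃(ω) = K_λ`), a finite place `w ∣ 3` of `M`, the Picard curve `C / M`
(`IsPicardCurve`), an integral model of `C` over the local ring `𝓞_{M,w} = valuationSubringAtPrime
M w` which is smooth of relative dimension `1` and proper — *good reduction at `w`*
[BouwEtAl2020, Def. 29], in the vocabulary of file `GoodReduction` — and whose special fibre over
the residue field `k(w)` has exactly two unit-root Frobenius eigenvalues (i.e. `3`-rank `2`: by the
proof of [BouwEtAl2020, Prop. 30] and Deuring–Šafarevič this is the two-branch-point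
Artin–Schreier type `x y³ - x y = g(x)`, the other good type `y³ - y = x⁴` having `3`-rank `0`),
these two being distinct (Frobenius of `k(w)` has two distinct eigenvalues on the rank-`2`
unit-root = étale part of `J[3^∞]`; a characteristic-`0` condition, see the module docstring).
[cite: BouwEtAl2020, Def. 29 and Prop. 30 (arXiv:1902.09624 numbering)] -/
structure MuOrdinaryModelAtThree (f : ℤ[X]) (M : Type) [Field M] [NumberField M] : Type 1 where
  /-- `M` contains a primitive cube root of unity `ω` (so that `M_w ⊇ ℚ₃(ω)`). -/
  exists_isPrimitiveRoot : ∃ ζ : M, IsPrimitiveRoot ζ 3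
  /-- The finite place of `M` at which the reduction is taken. -/
  w : HeightOneSpectrum (𝓞 M)
  /-- `w` lies above `3`. -/
  three_mem : (3 : 𝓞 M) ∈ w.asIdeal
  /-- The Picard curve `y³ = f(x)` over `M`. -/
  C : SchemeOver M
  /-- `C` is the smooth projective model of `y³ = f(x)` over `M`. -/
  isPicardCurve : IsPicardCurve f C
  /-- A model of `C` over the local ring `𝓞_{M,w}`. -/
  model : IntegralModel (valuationSubringAtPrime M w) M C
  /-- The model is smooth of relative dimension `1` and proper: good reduction at `w`. -/
  isSmoothProper : model.IsSmoothProper 1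
  /-- The special fibre over `k(w)` has `3`-rank `2` and its two unit-root Frobenius eigenvalues
  are distinct. -/
  hasSimpleUnitRoots : model.reductionAt.HasSimpleUnitRoots 2

namespace MuOrdinaryModelAtThree

variable {f : ℤ[X]} {M : Type} [Field M] [NumberField M] (W : MuOrdinaryModelAtThree f M)

/-- A witness exhibits good reduction of the Picard curve `W.C / M` at `w` in the sense of file
`GoodReduction` (`HasGoodReductionAt`, relative dimension `1`). [cite: BouwEtAl2020, Def. 29] -/
theorem hasGoodReductionAt : HasGoodReductionAt W.C 1 W.w :=
  ⟨W.model, W.isSmoothProper⟩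

/-- The special fibre of a witness is smooth of relative dimension `1` and proper over the
residue field `k(w)` (base change; `IntegralModel.IsSmoothProper.reductionAt`). [folklore] -/
theorem smooth_and_isProper_reductionAt :
    SmoothOfRelativeDimension 1 W.model.reductionAt.hom ∧ IsProper W.model.reductionAt.hom :=
  W.isSmoothProper.reductionAt

end MuOrdinaryModelAtThree

/-- **μ-ordinary potentially good reduction at `3`** of the Picard curve `y³ = f(x)`, `f ∈ ℤ[x]`
(intended for separable quartics): over SOME finite extension `M ∋ ω` of `ℚ` and SOME place
`w ∣ 3` of `M`, the curve has good reduction [BouwEtAl2020, Def. 29] with special fibre of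
`3`-rank `2` — equivalently [BouwEtAl2020, proof of Prop. 30] of two-branch-point Artin–Schreier
type `x y³ - x y = g(x)`, the μ-ordinary Newton polygon `(0, 0, ½, ½, 1, 1)` — and the Frobenius
of `k(w)` has two distinct eigenvalues on the rank-`2` unit-root (étale) part of `J[3^∞]`
(`λ`-distinguished). Defined as the existence of a number field `M` with a witness
`MuOrdinaryModelAtThree f M`; equivalent to the formulation over finite extensions of `ℚ₃(ω)`
(module docstring).
[cite: BouwEtAl2020, Def. 29 and Prop. 30 (arXiv:1902.09624 numbering)] -/
def HasMuOrdinaryReductionAtThree (f : ℤ[X]) : Prop :=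
  ∃ (M : Type) (_ : Field M) (_ : NumberField M), Nonempty (MuOrdinaryModelAtThree f M)

/-- Unfolding: `HasMuOrdinaryReductionAtThree f` is the existence of a number field `M` and a
witness over `M`. [folklore] -/
theorem hasMuOrdinaryReductionAtThree_iff (f : ℤ[X]) :
    HasMuOrdinaryReductionAtThree f ↔
      ∃ (M : Type) (_ : Field M) (_ : NumberField M), Nonempty (MuOrdinaryModelAtThree f M) :=
  Iff.rfl

/-- A witness over any number field `M` proves `HasMuOrdinaryReductionAtThree f`. [folklore] -/
theorem MuOrdinaryModelAtThree.hasMuOrdinaryReductionAtThree {f : ℤ[X]} {M : Type} [Field M]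
    [NumberField M] (W : MuOrdinaryModelAtThree f M) : HasMuOrdinaryReductionAtThree f :=
  ⟨M, ‹_›, ‹_›, ⟨W⟩⟩

end MuOrdinary

end Literature.AlgebraicGeometry.Motives

end
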